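import Summits.QuantumFields.BalabanUV.Beta.D1BFx.SplitRecut

/-!
# `BalabanUV.Beta.D1BFx.LamGroupPointwise` — road «BF-x» for binder row D1, slot (K), census group **G_Λ**: THE Λ-GROUP OF RE-CUT REST WORDS,
# SUMMED AT A FIXED BASE SITE AND DISPLACEMENT, IS TWO Λ⊗partner FINE BUBBLES AND ONE Λ₂-SLOT TADPOLE OVER THE FULL GLUON LEG
# (steps L «leg recombination — the frozen profile drops out» and S «partner-sector algebra» of an3-g53's LAMBDA-DICTIONARY v1 §2–§3;
# the first brick of the owner's «LAM-DICT», SPEC «K-END-RESHAPE-GROUPS» v1 §3 `hGrp gΛ`)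

HONEST DEPENDENCY (page 1, mandatory): continuum YM on T⁴ ⇐ BetaPertH ∧ nine spine estimates (0/9 proved); BetaPertH ⇐ (D1) ∧ (D4) ∧
CAP+tail; G-an2-4 gates asym, D1 and NE2/3/4.  HONEST FRAMING (cell contract, verbatim): «discharging `BetaPertH` makes Bałaban's UV
stability UNCONDITIONAL — a real constructive-QFT result; it is NOT the continuum limit and NOT the Clay problem.»  THIS MODULE DISCHARGES
NOTHING of the wall: ONE definition with a body ([our object] `lamFibre`, the finite index set of the G_Λ group — the 45 re-cut gluon bubble words
with a Λ-sector vertex and the 3 Λ₂-slot tadpole words — as a `Finset RestIdx`) and [folklore] finite-sum bookkeeping BY NAME over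
`SplitRecut.restK'_bub`∕`restK'_tad`, `FineHessianLegGrades.biBubbleTable_Ga_eq_pieceSum`∕`tadpoleTable_eq_pieceSum` (leg recombination),
`SectorRecut.SbfBal_eq_secSum'`∕`loc_secSt'` and the bubble's bilinearity (`TameKernelCalculus.bubble_add_left`,
`DressedBubbleBridge.bubble_finset_sum_right`, `StencilRealisation.bubble_smul_left∕right`).  No `Prop` is minted, nothing is cited, no
hypothesis is a printed statement, 0 sorry.  NO bound, NO letter (in particular not the zero-momentum letter), NO estimate; 0 wall binders;
(K) NOT closed; NOT D1, NOT `BetaPertH`, NOT continuum, NOT Clay.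

ABSOLUTE RULE (cell charter, verbatim): «No internally-minted statement may enter as a cited fact. Every hypothesis is either kernel-proved in
this package or a verbatim quotation of a PUBLISHED theorem with page reference. The manuscript(s) under audit are NOT citable for their own
disputed steps — they are the thing under adjudication; programme-internal (2001/route/tribunal) claims are never citable.»

WHY (an3-g53 `gen53/LAMBDA-DICTIONARY.v1.md` §0 (V1), owner ruling ρ-g9-14).  The END of record (`RoadEndBFxTotalShellGroups.d1Drift_BFx_total_shell_of_prop12_of_groups`,
p252741) displays ONE hypothesis per identity-closed group of rest words; the Λ-group is bounded (indeed zero) only as a GROUP.  Summed FIRST over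
the leg grades `r r′ : Fin 3` the frozen profile `g` recombines into the full gluon leg `Ga n a` (`legPiece 0 + legPiece 1 + legPiece 2 = Ga`), and
THEN over the partner sectors the five Λ-words collapse, by bilinearity, to TWO bubbles: `Λ ⊗ S_full` (Λ in the first slot) and
`(cE•SbT + SbRc) ⊗ Λ = (S_full − cΛ•Λ) ⊗ Λ` (Λ in the second slot); the three Λ₂-slot tadpole words recombine to the tadpole table of `WΛ` over `Ga`.

CONTENT.
* §1 [our object] **`lamFibre`**; `mem_lamFibre_bub`, `mem_lamFibre_tad`, `sum_lamFibre` (the sum over the group as «45 bubble words + 3 tadpole words»).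
* §2 [folklore] `SbfBal_sub_SbL` (`S_full − cΛ•SbL = cE•SbT + SbRc`, from `SbfBal_eq_secSum'`); **`sum_lamFibre_restK'`** — THE POINTWISE IDENTITY
  at a base site `b` and displacement `w`, for ANY exponentially bounded profile `g` (in the END: `gfrz n a b`), `0 < a`, `Spr (Ga n a)`, the Λ₂ slot
  table bi-localised (`hΛ`, the END's socket), `μ ν` arbitrary:
  `Σ_{τ ∈ lamFibre} restK' … b τ w = ωgl·n⁻⁸·w_μ·w_ν·( cΛ·biBubbleTable Ga Ga (SbL n) S_full μ ν (b+w) b + cΛ·biBubbleTable Ga Ga (S_full − cΛ•SbL n) (SbL n) μ ν (b+w) b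
     + cΛ₂·tadpoleTable n a WΛ μ ν (b+w) b )`, `S_full := SbfBal n a cE cVH cΛ cR cK cQ` (any `cVH`).
Unit `b2b-balaban-gan24-formalise-leaf-05` (gen 40), G-an2-4 swarm leaf prover on cross-lane kernel duty for road «BF-x» (owner d1-p2).
-/

noncomputable section

namespace Summit.QuantumFields.BalabanUV.Beta.D1BFx.LamGroupPointwise

open Finset
open scoped BigOperators
open Literature.MathematicalPhysics.QuantumFieldTheory.Balaban1983to89
open Literature.MathematicalPhysics.QuantumFieldTheory.Balaban1983to89.Beta
open B12Sec2to5 (l1)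
open ExpKernelCalculus (Site MKer BiLoc bubble)
open DyadicShell (Pt toReal)
open Summit.QuantumFields.BalabanUV.Beta.TameKernelCalculus (Spr Loc bubble_add_left)
open Summit.QuantumFields.BalabanUV.Beta.D1BFx.PackedKernelSplit (biBubble bubble_eq_biBubble)
open Summit.QuantumFields.BalabanUV.Beta.D1BFx.StencilRealisation (bubble_smul_left bubble_smul_right)
open Summit.QuantumFields.BalabanUV.Beta.D1BFx.DressedBubbleBridge (bubble_finset_sum_right)
open Summit.QuantumFields.BalabanUV.Beta.D1BFx.MomentTransferPeriodic (baseKer)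
open Summit.QuantumFields.BalabanUV.Beta.D1BFx.GluonLeg (Ga)
open Summit.QuantumFields.BalabanUV.Beta.D1BFx.ReducedKernel (StencilR TableR)
open Summit.QuantumFields.BalabanUV.Beta.D1BFx.DressedTadpoleTable (tadpoleTable tadpoleTable_apply)
open Summit.QuantumFields.BalabanUV.Beta.D1BFx.DressedTablesLeg (tadpoleTableA tadpoleTableA_apply)
open Summit.QuantumFields.BalabanUV.Beta.D1BFx.FineStencilBFBalaban (SbfBal)
open Summit.QuantumFields.BalabanUV.Beta.D1BFx.GluonKernelSectors (SbL)
open Summit.QuantumFields.BalabanUV.Beta.D1BFx.FineHessianSectors (biBubbleTable biBubbleTable_apply slotWt slotTab)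
open Summit.QuantumFields.BalabanUV.Beta.D1BFx.FineHessianLegGrades (legPiece biBubbleTable_Ga_eq_pieceSum tadpoleTable_eq_pieceSum)
open Summit.QuantumFields.BalabanUV.Beta.D1BFx.SplitInstance (RestIdx sum4_prod)
open Summit.QuantumFields.BalabanUV.Beta.D1BFx.SectorRecut (SbT SbRc secSt' secWt' secSt'_zero secSt'_one secSt'_two secWt'_zero secWt'_one
  secWt'_two SbfBal_eq_secSum' loc_secSt')
open Summit.QuantumFields.BalabanUV.Beta.D1BFx.SplitRecut (restK' restK'_bub restK'_tad)

/-! ## §1 The index set of the Λ-group -/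

/-- [our object] The Λ-SECTOR BUBBLE WORD INDICES: `(s, s′, r, r′)` with a Λ-sector vertex, `s = 1 ∨ s′ = 1` (5 sector pairs × 9 leg grades = 45 words). -/
def lamBub : Finset (Fin 3 × Fin 3 × Fin 3 × Fin 3) := univ.filter fun x => x.1 = 1 ∨ x.2.1 = 1

/-- [our object] **THE INDEX SET OF THE G_Λ GROUP OF RE-CUT REST WORDS** (SPEC «K-END-RESHAPE-GROUPS» v1 §2, `grp τ = 1`): the 45 gluon bubble words
with a Λ-sector vertex `Sum.inr (Sum.inl (s, s′, r, r′))`, `s = 1 ∨ s′ = 1`, and the 3 Λ₂-slot tadpole words `Sum.inl (2, r)`.  A DEFINITION (data). -/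
def lamFibre : Finset RestIdx :=
  lamBub.map ⟨fun x => Sum.inr (Sum.inl x), fun _ _ h => Sum.inl_injective (Sum.inr_injective h)⟩
    ∪ (univ : Finset (Fin 3)).map ⟨fun r => Sum.inl ((2 : Fin 5), r), fun _ _ h => (Prod.mk.inj (Sum.inl_injective h)).2⟩

/-- [our object] Membership: a gluon bubble word is in the Λ-group iff one of its two sector indices is `1`. -/
theorem mem_lamFibre_bub (x : Fin 3 × Fin 3 × Fin 3 × Fin 3) : (Sum.inr (Sum.inl x) : RestIdx) ∈ lamFibre ↔ (x.1 = 1 ∨ x.2.1 = 1) := by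
  simp [lamFibre, lamBub]

/-- [our object] Membership: a gluon tadpole word `(s, r)` is in the Λ-group iff its slot is the Λ₂ slot `s = 2`. -/
theorem mem_lamFibre_tad (x : Fin 5 × Fin 3) : (Sum.inl x : RestIdx) ∈ lamFibre ↔ x.1 = 2 := by
  obtain ⟨s, r⟩ := x
  constructor
  · intro h
    simp only [lamFibre, mem_union, mem_map, Function.Embedding.coeFn_mk, mem_univ, true_and] at h
    rcases h with ⟨_, _, h⟩ | ⟨r', h⟩
    · cases h
    · exact (congrArg Prod.fst (Sum.inl_injective h)).symm
  · rintro (rfl : s = 2)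
    simp only [lamFibre, mem_union, mem_map, Function.Embedding.coeFn_mk, mem_univ, true_and]
    exact Or.inr ⟨r, rfl⟩

/-- [our object] No ghost word and no corner∕cross word is in the Λ-group. -/
theorem not_mem_lamFibre_inr_inr (y : Fin 2 ⊕ (Fin 2 × Fin 2 × Fin 2 × Fin 2) ⊕ Fin 2) : (Sum.inr (Sum.inr y) : RestIdx) ∉ lamFibre := by
  simp [lamFibre]

/-- [folklore] **THE SUM OVER THE Λ-GROUP AS «45 BUBBLE WORDS + 3 TADPOLE WORDS».** -/
theorem sum_lamFibre (f : RestIdx → ℝ) :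
    ∑ τ ∈ lamFibre, f τ = (∑ x ∈ lamBub, f (Sum.inr (Sum.inl x))) + ∑ r : Fin 3, f (Sum.inl ((2 : Fin 5), r)) := by
  rw [lamFibre, sum_union, sum_map, sum_map]
  · rfl
  · rw [disjoint_left]
    intro τ h₁ h₂
    simp only [mem_map, Function.Embedding.coeFn_mk, mem_univ, true_and] at h₁ h₂
    obtain ⟨_, _, rfl⟩ := h₁
    obtain ⟨_, h⟩ := h₂
    cases h

/-! ## §2 The pointwise identity: leg recombination, then partner-sector algebra -/

section Pointwise

variable (n : ℕ) [NeZero n] (a : ℝ) {g : Pt → ℝ} (cE cVH cΛ cR cK cQ cE₂ cJ4 cΛ₂ cR₂ cQ₂ x₀ : ℝ) (WE WJ WΛ WR WQ : TableR)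
  (ωgl ωgh lam N : ℝ) (μ ν : Fin 4) (b : Pt) {C δ CΛt δW : ℝ}

/-- [folklore] **THE μ-SIDE PARTNER OF Λ**: `S_full κ u − cΛ • SbL n κ u = cE • SbT κ u + SbRc n a cE cR cK cQ κ u` (the re-cut decomposition
`SectorRecut.SbfBal_eq_secSum'` with the Λ-term moved). -/
theorem SbfBal_sub_SbL (κ : Fin 4) (u : Site 4) :
    SbfBal n a cE cVH cΛ cR cK cQ κ u - cΛ • SbL n κ u = cE • SbT κ u + SbRc n a cE cR cK cQ κ u := by
  rw [SbfBal_eq_secSum' n a cE cVH cΛ cR cK cQ κ u, Fin.sum_univ_three, secWt'_zero, secWt'_one, secWt'_two, secSt'_zero, secSt'_one,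
    secSt'_two, one_smul]
  abel

/-- [folklore] Leg recombination + sector algebra for the 45 BUBBLE WORDS of the Λ-group at `(b, w)`: they sum to
`ωgl·n⁻⁸·w_μw_ν·cΛ·( biBubbleTable Ga Ga (SbL n) S_full + biBubbleTable Ga Ga (S_full − cΛ•SbL n) (SbL n) ) μ ν (b+w) b`. -/
theorem sum_lamBub_restK' (ha : 0 < a) (hGa : Spr (Ga n a)) (hδ : 0 < δ) (hg : ∀ v, |g v| ≤ C * Real.exp (-δ * l1 v)) (w : Pt) :
    ∑ x ∈ lamBub, restK' n a g cE cΛ cR cK cQ cE₂ cJ4 cΛ₂ cR₂ cQ₂ x₀ WE WJ WΛ WR WQ ωgl ωgh lam N μ ν b (Sum.inr (Sum.inl x)) w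
      = ωgl * (((n : ℝ) ^ 8)⁻¹ * (toReal w μ * toReal w ν * (cΛ *
          (biBubbleTable (Ga n a) (Ga n a) (SbL n) (SbfBal n a cE cVH cΛ cR cK cQ) μ ν (b + w) b
            + biBubbleTable (Ga n a) (Ga n a) (fun κ u => SbfBal n a cE cVH cΛ cR cK cQ κ u - cΛ • SbL n κ u) (SbL n) μ ν (b + w) b)))) := by
  have hloc : ∀ (s : Fin 3) (κ : Fin 4) (u : Site 4), Loc (secSt' n a cE cR cK cQ s κ u) := fun s κ u => loc_secSt' n a cE cR cK cQ ha s κ u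
  -- (1) every Λ-word is off the `0000` word, so `restK'_bub`'s `if` is false; unfold and recombine the legs word by word in `(s, s′)`-fibres
  have hword : ∀ x ∈ lamBub, restK' n a g cE cΛ cR cK cQ cE₂ cJ4 cΛ₂ cR₂ cQ₂ x₀ WE WJ WΛ WR WQ ωgl ωgh lam N μ ν b (Sum.inr (Sum.inl x)) w
      = ωgl * (secWt' cE cΛ x.1 * secWt' cE cΛ x.2.1 * (((n : ℝ) ^ 8)⁻¹ * (toReal w μ * toReal w ν *
          biBubbleTable (legPiece n a g x.2.2.1) (legPiece n a g x.2.2.2) (secSt' n a cE cR cK cQ x.1) (secSt' n a cE cR cK cQ x.2.1) μ ν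
            (b + w) b))) := by
    intro x hx
    have hx' : x.1 = 1 ∨ x.2.1 = 1 := (mem_filter.1 hx).2
    have hne : x ≠ ((0 : Fin 3), (0 : Fin 3), (0 : Fin 3), (0 : Fin 3)) := by
      rintro rfl
      rcases hx' with h | h <;> exact absurd h (by decide)
    rw [restK'_bub, if_neg hne]
    rfl
  rw [sum_congr rfl hword]
  -- (2) pass to the sum over all of `Fin 3 × Fin 3 × Fin 3 × Fin 3` with an indicator, split the product, recombine the legs in each `(s, s′)`-fibre
  have hind : ∑ x ∈ lamBub, ωgl * (secWt' cE cΛ x.1 * secWt' cE cΛ x.2.1 * (((n : ℝ) ^ 8)⁻¹ * (toReal w μ * toReal w ν *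
          biBubbleTable (legPiece n a g x.2.2.1) (legPiece n a g x.2.2.2) (secSt' n a cE cR cK cQ x.1) (secSt' n a cE cR cK cQ x.2.1) μ ν
            (b + w) b)))
      = ∑ s : Fin 3, ∑ s' : Fin 3, if (s = 1 ∨ s' = 1) then ωgl * (secWt' cE cΛ s * secWt' cE cΛ s' * (((n : ℝ) ^ 8)⁻¹ *
          (toReal w μ * toReal w ν * biBubbleTable (Ga n a) (Ga n a) (secSt' n a cE cR cK cQ s) (secSt' n a cE cR cK cQ s') μ ν (b + w) b)))
        else 0 := by
    rw [lamBub, sum_filter, ← sum4_prod (fun s s' r r' => if (s = 1 ∨ s' = 1) then ωgl * (secWt' cE cΛ s * secWt' cE cΛ s' *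
      (((n : ℝ) ^ 8)⁻¹ * (toReal w μ * toReal w ν * biBubbleTable (legPiece n a g r) (legPiece n a g r') (secSt' n a cE cR cK cQ s)
        (secSt' n a cE cR cK cQ s') μ ν (b + w) b))) else 0)]
    refine sum_congr rfl fun s _ => sum_congr rfl fun s' _ => ?_
    by_cases hs : s = 1 ∨ s' = 1
    · simp only [if_pos hs]
      rw [biBubbleTable_Ga_eq_pieceSum n a hGa hδ hg (hloc s) (hloc s') μ ν (b + w) b]
      simp only [mul_sum]
    · simp only [if_neg hs, sum_const_zero]
  rw [hind]
  -- (3) evaluate the nine-term indicator sum: five words survive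
  have h01 : ((0 : Fin 3) = 1) ↔ False := by decide
  have h21 : ((2 : Fin 3) = 1) ↔ False := by decide
  simp only [Fin.sum_univ_three, Fin.isValue, h01, h21, or_true, or_false, if_true, if_false, zero_add, add_zero,
    secWt'_zero, secWt'_one, secWt'_two, secSt'_zero, secSt'_one, secSt'_two]
  -- (4) the two partner bubbles over the full leg, expanded by bilinearity into the same five sector bubbles
  have hL : ∀ (κ : Fin 4) (u : Site 4), Loc (SbL n κ u) := fun κ u => by
    have h := hloc 1 κ u; rwa [secSt'_one] at h
  have h1 : biBubbleTable (Ga n a) (Ga n a) (SbL n) (SbfBal n a cE cVH cΛ cR cK cQ) μ ν (b + w) b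
      = -(1 / 2 : ℝ) * (cE * bubble (Ga n a) (SbL n μ (b + w)) (SbT ν b) + cΛ * bubble (Ga n a) (SbL n μ (b + w)) (SbL n ν b)
          + bubble (Ga n a) (SbL n μ (b + w)) (SbRc n a cE cR cK cQ ν b)) := by
    rw [biBubbleTable_apply, ← bubble_eq_biBubble, SbfBal_eq_secSum' n a cE cVH cΛ cR cK cQ ν b,
      bubble_finset_sum_right univ hGa (hL μ (b + w)) (fun j => (hloc j ν b).smul (secWt' cE cΛ j))]
    simp only [Fin.sum_univ_three, Fin.isValue, bubble_smul_right, secWt'_zero, secWt'_one, secWt'_two, secSt'_zero, secSt'_one, secSt'_two,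
      one_mul]
  have h2 : biBubbleTable (Ga n a) (Ga n a) (fun κ u => SbfBal n a cE cVH cΛ cR cK cQ κ u - cΛ • SbL n κ u) (SbL n) μ ν (b + w) b
      = -(1 / 2 : ℝ) * (cE * bubble (Ga n a) (SbT μ (b + w)) (SbL n ν b) + bubble (Ga n a) (SbRc n a cE cR cK cQ μ (b + w)) (SbL n ν b)) := by
    rw [biBubbleTable_apply, ← bubble_eq_biBubble, SbfBal_sub_SbL]
    have hT : Loc (SbT μ (b + w)) := by have h := hloc 0 μ (b + w); rwa [secSt'_zero] at h
    have hRc : Loc (SbRc n a cE cR cK cQ μ (b + w)) := by have h := hloc 2 μ (b + w); rwa [secSt'_two] at h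
    rw [bubble_add_left hGa (hT.smul cE) hRc (hL ν b), bubble_smul_left]
  rw [h1, h2]
  simp only [biBubbleTable_apply, ← bubble_eq_biBubble]
  ring

/-- [folklore] Leg recombination for the 3 Λ₂-SLOT TADPOLE WORDS of the Λ-group at `(b, w)`: they sum to `ωgl·cΛ₂·n⁻⁸·w_μw_ν·tadpoleTable n a WΛ μ ν (b+w) b`
(the slot table bi-localised at its two bonds — the END's socket `hΛ`). -/
theorem sum_lamTad_restK' (hGa : Spr (Ga n a)) (hδ : 0 < δ) (hg : ∀ v, |g v| ≤ C * Real.exp (-δ * l1 v)) (hδW : 0 < δW)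
    (hΛ : ∀ κ u l u', BiLoc (WΛ κ u l u') u u' CΛt δW) (w : Pt) :
    ∑ r : Fin 3, restK' n a g cE cΛ cR cK cQ cE₂ cJ4 cΛ₂ cR₂ cQ₂ x₀ WE WJ WΛ WR WQ ωgl ωgh lam N μ ν b (Sum.inl ((2 : Fin 5), r)) w
      = ωgl * (cΛ₂ * (((n : ℝ) ^ 8)⁻¹ * (toReal w μ * toReal w ν * tadpoleTable n a WΛ μ ν (b + w) b))) := by
  have hWloc : ∀ κ u l u', Loc (WΛ κ u l u') := fun κ u l u' => ⟨u, u', CΛt, δW, hδW, hΛ κ u l u'⟩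
  have hword : ∀ r : Fin 3, restK' n a g cE cΛ cR cK cQ cE₂ cJ4 cΛ₂ cR₂ cQ₂ x₀ WE WJ WΛ WR WQ ωgl ωgh lam N μ ν b (Sum.inl ((2 : Fin 5), r)) w
      = ωgl * (cΛ₂ * (((n : ℝ) ^ 8)⁻¹ * (toReal w μ * toReal w ν * tadpoleTableA (legPiece n a g r) WΛ μ ν (b + w) b))) := by
    intro r
    rw [restK'_tad]
    rfl
  simp only [hword, ← mul_sum]
  rw [tadpoleTable_eq_pieceSum n a hGa hδ hg hWloc μ ν (b + w) b]

/-- [folklore] **THE Λ-GROUP OF RE-CUT REST WORDS AT A BASE SITE AND A DISPLACEMENT IS TWO Λ⊗partner BUBBLES AND ONE Λ₂ TADPOLE OVER THE FULL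
GLUON LEG** (an3-g53 LAMBDA-DICTIONARY v1 (GΛ) + §3): for ANY exponentially bounded profile `g` (the frozen profile `gfrz n a b` in the END — it has
DROPPED OUT on the right), `0 < a`, `Spr (Ga n a)`, the Λ₂-slot table bi-localised at its bonds:
`Σ_{τ ∈ lamFibre} restK' … b τ w = ωgl·n⁻⁸·w_μw_ν·( cΛ·biBubbleTable Ga Ga (SbL n) S_full μ ν (b+w) b + cΛ·biBubbleTable Ga Ga (S_full − cΛ•SbL n) (SbL n) μ ν (b+w) b
  + cΛ₂·tadpoleTable n a WΛ μ ν (b+w) b )`, `S_full = SbfBal n a cE cVH cΛ cR cK cQ` (any `cVH`). -/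
theorem sum_lamFibre_restK' (ha : 0 < a) (hGa : Spr (Ga n a)) (hδ : 0 < δ) (hg : ∀ v, |g v| ≤ C * Real.exp (-δ * l1 v)) (hδW : 0 < δW)
    (hΛ : ∀ κ u l u', BiLoc (WΛ κ u l u') u u' CΛt δW) (w : Pt) :
    ∑ τ ∈ lamFibre, restK' n a g cE cΛ cR cK cQ cE₂ cJ4 cΛ₂ cR₂ cQ₂ x₀ WE WJ WΛ WR WQ ωgl ωgh lam N μ ν b τ w
      = ωgl * (((n : ℝ) ^ 8)⁻¹ * (toReal w μ * toReal w ν *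
          (cΛ * biBubbleTable (Ga n a) (Ga n a) (SbL n) (SbfBal n a cE cVH cΛ cR cK cQ) μ ν (b + w) b
            + cΛ * biBubbleTable (Ga n a) (Ga n a) (fun κ u => SbfBal n a cE cVH cΛ cR cK cQ κ u - cΛ • SbL n κ u) (SbL n) μ ν (b + w) b
            + cΛ₂ * tadpoleTable n a WΛ μ ν (b + w) b))) := by
  rw [sum_lamFibre, sum_lamBub_restK' n a cE cVH cΛ cR cK cQ cE₂ cJ4 cΛ₂ cR₂ cQ₂ x₀ WE WJ WΛ WR WQ ωgl ωgh lam N μ ν b ha hGa hδ hg w,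
    sum_lamTad_restK' n a cE cΛ cR cK cQ cE₂ cJ4 cΛ₂ cR₂ cQ₂ x₀ WE WJ WΛ WR WQ ωgl ωgh lam N μ ν b hGa hδ hg hδW hΛ w]
  ring

end Pointwise

end Summit.QuantumFields.BalabanUV.Beta.D1BFx.LamGroupPointwise

end
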